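import Mathlib.Probability.Distributions.Gaussian.HasGaussianLaw.Independence
import Mathlib.Probability.Independence.Basic
import Mathlib.MeasureTheory.Integral.Prod

/-!
# T⁴ programme, spine node NE1′ (O3b/H2), COUPLING LINE — TIER A of leaf L6 / the open estimate (I) of the skeleton
# `t4/skeletons/NE1p-t4-ne1p-p3.md` (v0.7 §3b): in the GAUSSIAN model with LINEAR averaging the conditional law of the fine
# field given the block field is a FIXED law translated by a LINEAR function of the block field (Gaussian regression); so the
# «cross-scale anisotropy given the unit field» is carried by the regression (interpolation) map alone — exact, no loss in the
# number of scales

Cell `pub-balaban`, unit `b2b-balaban-t4-ne1p-p3` (ROUND-2 technique-distinct prover #3 on BINDER row NE1′, technique «coupling of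
block-spin towers»), generation 30; item (m2) «abelian Gaussian TIER A» of the division of labour agreed with road P4 (`t4-ne1p-p4`,
journal l.5166/5175/5206; P4's first falsifier R-P4-1 and this line's F2 live in this model).  OUR elementary theorem (new work ⇒
`Summits/`), Mathlib only (`ProbabilityTheory.HasGaussianLaw`, `HasGaussianLaw.indepFun_of_covariance_strongDual`, Fubini); everything
is PROVED; nothing is a `def … : Prop`; nothing of T. Bałaban's series is asserted or cited.

HONEST FRAMING (T4-DAG p. 1).  Rung (B)+1 on ONE finite four-torus of fixed physical size; NOT infinite volume, NOT a mass gap,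
NOT the Clay problem, NOT summit progress.  This file is a MODEL-LEVEL check of the FORMULATION of the line's one open estimate
((I) `CrossScaleAnisotropy` ≡ road P4's `StepSupply.contract`/L8), not a step towards it for Bałaban's non-Gaussian densities.
HONEST DEPENDENCY (verbatim): continuum YM on T⁴ ⇐ BetaPertH ∧ nine spine estimates (0/9 proved); BetaPertH ⇐ (D1) ∧ (D4) ∧ CAP+tail;
G-an2-4 gates asym, D1 and NE2/3/4.

DICTIONARY (prose, not asserted).  `X : Ω → V` = the fine (level-`k`) Gaussian field of the linearised model ([Balaban1984PropagatorsI]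
(1.6)–(1.7) is the cell's model of record, T4-EST-O3cE2 — not used here); `Q : V →L W` = the `n`-fold LINEAR block averaging to the
unit lattice, `Y = Q X` = the unit field `y`; `M : W →L V` = the regression / interpolation map («minimiser» `ℳ_n`), characterised
here by the ORTHOGONALITY hypothesis `horth` (the residual `X − M Q X` is uncorrelated with `Q X`; for a non-degenerate covariance of
`Y` this is `M = C Qᵀ (Q C Qᵀ)⁻¹` — linear algebra, not re-derived here); `Z = X − M Q X` = the fluctuation field.

WHAT IS PROVED ([folklore] = Gaussian regression).
* `hasGaussianLaw_resid_prod` — `(X − MQX, QX)` is jointly Gaussian (continuous linear image of `X`);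
* `indepFun_resid` — under `horth`, the residual `Z = X − MQX` is INDEPENDENT of the block field `Y = QX`;
* `integral_mul_comp_eq` — THE CONDITIONAL LAW IN TEST-FUNCTION FORM: for bounded measurable `F : V → ℝ`, `g : W → ℝ`,
  `E[F(X)·g(Y)] = E[Φ(Y)·g(Y)]` with `Φ(y) = E[F(M y + Z)]` — i.e. `E[F(X) ∣ Y] = Φ(Y)`: given the unit field `y`, the fine
  field is the FIXED law of `Z` translated by `M y`.  Reading for the skeleton (§3b (ii)/(iii)): every conditional statistic of the
  fine field depends on `y` only through the linear interpolation `M y` (the «mean's curvature»); the fluctuation part is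
  `y`-independent — (I) holds in the model with the constant of `M` and WITHOUT the factor `(n+1)`.
NOT PROVED, NOT CLAIMED: existence/formula of `M` (hypothesis `horth`); the curvature scaling `‖curvature of M y‖ = L^{−2n}·‖unit
curvature‖` for Bałaban's block averaging (leaf L6 (G), printed for the non-linear minimisers as [Balaban1987RG1] (1.17), not touched
here); anything non-Gaussian.
-/

noncomputable section

open MeasureTheory ProbabilityTheory

namespace Summit.QuantumFields.BalabanUV.T4Continuum.NE1pGaussianRegression

variable {Ω : Type*} {mΩ : MeasurableSpace Ω} {P : Measure Ω}
variable {V W : Type*}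
  [NormedAddCommGroup V] [NormedSpace ℝ V] [MeasurableSpace V] [BorelSpace V] [CompleteSpace V]
  [SecondCountableTopology V]
  [NormedAddCommGroup W] [NormedSpace ℝ W] [MeasurableSpace W] [BorelSpace W] [CompleteSpace W]
  [SecondCountableTopology W]
variable {X : Ω → V}

omit [CompleteSpace V] [SecondCountableTopology V] [CompleteSpace W] in
/-- **JOINT GAUSSIANITY OF (RESIDUAL, BLOCK FIELD)**: `(X − MQX, QX)` is the image of `X` under the continuous linear map
`((id − M∘Q), Q)`, hence Gaussian. [folklore] -/
theorem hasGaussianLaw_resid_prod (hX : HasGaussianLaw X P) (Q : V →L[ℝ] W) (M : W →L[ℝ] V) :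
    HasGaussianLaw (fun ω => (X ω - M (Q (X ω)), Q (X ω))) P := by
  have h := hX.map_fun ((ContinuousLinearMap.id ℝ V - M.comp Q).prod Q)
  have e : (fun ω => (X ω - M (Q (X ω)), Q (X ω))) = fun ω => ((ContinuousLinearMap.id ℝ V - M.comp Q).prod Q) (X ω) := by
    funext ω
    simp
  rw [e]
  exact h

/-- **GAUSSIAN REGRESSION**: if the residual `X − MQX` is UNCORRELATED with the block field `QX` (every pair of continuous linear
functionals has covariance `0`), then it is INDEPENDENT of it (jointly Gaussian + uncorrelated ⇒ independent, Mathlib). [folklore] -/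
theorem indepFun_resid (hX : HasGaussianLaw X P) (Q : V →L[ℝ] W) (M : W →L[ℝ] V)
    (horth : ∀ (a : StrongDual ℝ V) (b : StrongDual ℝ W),
      cov[fun ω => a (X ω - M (Q (X ω))), fun ω => b (Q (X ω)); P] = 0) :
    IndepFun (fun ω => X ω - M (Q (X ω))) (fun ω => Q (X ω)) P :=
  (hasGaussianLaw_resid_prod hX Q M).indepFun_of_covariance_strongDual fun a b => horth a b

/-- **THE CONDITIONAL LAW OF THE FINE FIELD GIVEN THE BLOCK FIELD, TEST-FUNCTION FORM**: for bounded measurable `F`, `g`,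
`E[F(X)·g(QX)] = E[Φ(QX)·g(QX)]` with `Φ(y) = E[F(M y + Z)]`, `Z = X − MQX` — the conditional law given the unit field `y` is the
fixed law of the fluctuation field translated by the linear interpolation `M y`. [folklore] -/
theorem integral_mul_comp_eq (hX : HasGaussianLaw X P) (Q : V →L[ℝ] W) (M : W →L[ℝ] V)
    (horth : ∀ (a : StrongDual ℝ V) (b : StrongDual ℝ W),
      cov[fun ω => a (X ω - M (Q (X ω))), fun ω => b (Q (X ω)); P] = 0)
    {F : V → ℝ} {g : W → ℝ} (hF : Measurable F) (hg : Measurable g) {CF Cg : ℝ} (hFb : ∀ v, |F v| ≤ CF)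
    (hgb : ∀ w, |g w| ≤ Cg) :
    ∫ ω, F (X ω) * g (Q (X ω)) ∂P
      = ∫ ω, (∫ ω', F (M (Q (X ω)) + (X ω' - M (Q (X ω')))) ∂P) * g (Q (X ω)) ∂P := by
  have hP : IsProbabilityMeasure P := hX.isProbabilityMeasure
  set Z : Ω → V := fun ω => X ω - M (Q (X ω)) with hZdef
  set Y : Ω → W := fun ω => Q (X ω) with hYdef
  have hXm : AEMeasurable X P := hX.aemeasurable
  have hYm : AEMeasurable Y P := Q.continuous.measurable.comp_aemeasurable hXm
  have hZm : AEMeasurable Z P := hXm.sub (M.continuous.measurable.comp_aemeasurable hYm)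
  have hind : IndepFun Z Y P := indepFun_resid hX Q M horth
  have hmap : P.map (fun ω => (Z ω, Y ω)) = (P.map Z).prod (P.map Y) :=
    (indepFun_iff_map_prod_eq_prod_map_map hZm hYm).1 hind
  haveI : IsProbabilityMeasure (P.map Z) := Measure.isProbabilityMeasure_map hZm
  haveI : IsProbabilityMeasure (P.map Y) := Measure.isProbabilityMeasure_map hYm
  -- the two-variable test function
  set h : V × W → ℝ := fun p => F (M p.2 + p.1) * g p.2 with hhdef
  have hhm : Measurable h :=
    (hF.comp ((M.continuous.measurable.comp measurable_snd).add measurable_fst)).mul (hg.comp measurable_snd)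
  have hCF : 0 ≤ CF := (abs_nonneg _).trans (hFb 0)
  have hhb : ∀ p, |h p| ≤ CF * Cg := fun p => by
    rw [hhdef, abs_mul]
    exact mul_le_mul (hFb _) (hgb _) (abs_nonneg _) hCF
  have hint : Integrable h ((P.map Z).prod (P.map Y)) :=
    (integrable_const (CF * Cg)).mono' hhm.aestronglyMeasurable
      (Filter.Eventually.of_forall fun p => by rw [Real.norm_eq_abs]; exact hhb p)
  -- left side = ∫ h (Z, Y) dP = ∫ h d(law Z ⊗ law Y) = ∫ y ∫ z h (z, y)
  have eL : (fun ω => F (X ω) * g (Q (X ω))) = fun ω => h (Z ω, Y ω) := by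
    funext ω
    simp [hhdef, hZdef, hYdef]
  have e1 : ∫ ω, h (Z ω, Y ω) ∂P = ∫ p, h p ∂(P.map fun ω => (Z ω, Y ω)) :=
    (integral_map (hZm.prodMk hYm) hhm.aestronglyMeasurable).symm
  have e2 : ∫ p, h p ∂((P.map Z).prod (P.map Y)) = ∫ y, ∫ z, h (z, y) ∂(P.map Z) ∂(P.map Y) :=
    integral_prod_symm h hint
  -- right side = ∫ Φ(Y) g(Y) dP = ∫ y, Φ y * g y d(law Y), Φ y = ∫ z, F (M y + z) d(law Z)
  have eΦ : ∀ y : W, ∫ ω', F (M y + (X ω' - M (Q (X ω')))) ∂P = ∫ z, F (M y + z) ∂(P.map Z) := fun y =>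
    (integral_map hZm (hF.comp (measurable_const.add measurable_id)).aestronglyMeasurable).symm
  have einner : ∀ y : W, ∫ z, h (z, y) ∂(P.map Z) = (∫ z, F (M y + z) ∂(P.map Z)) * g y := fun y => by
    simp only [hhdef]
    exact integral_mul_const _ _
  have hΦg_meas : Measurable fun y : W => (∫ z, F (M y + z) ∂(P.map Z)) * g y := by
    have hsm : StronglyMeasurable fun y : W => ∫ z, h (z, y) ∂(P.map Z) :=
      hhm.stronglyMeasurable.integral_prod_left'
    have e : (fun y : W => ∫ z, h (z, y) ∂(P.map Z)) = fun y => (∫ z, F (M y + z) ∂(P.map Z)) * g y := funext einner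
    rw [← e]
    exact hsm.measurable
  have eR : ∫ ω, (∫ ω', F (M (Q (X ω)) + (X ω' - M (Q (X ω')))) ∂P) * g (Q (X ω)) ∂P
      = ∫ y, (∫ z, F (M y + z) ∂(P.map Z)) * g y ∂(P.map Y) := by
    have e3 : (fun ω => (∫ ω', F (M (Q (X ω)) + (X ω' - M (Q (X ω')))) ∂P) * g (Q (X ω)))
        = fun ω => (fun y : W => (∫ z, F (M y + z) ∂(P.map Z)) * g y) (Y ω) := by
      funext ω
      simp only [hYdef, eΦ]
    rw [e3]
    exact (integral_map hYm hΦg_meas.aestronglyMeasurable).symm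
  rw [eL, e1, hmap, e2, eR]
  exact integral_congr_ae (Filter.Eventually.of_forall einner)

end Summit.QuantumFields.BalabanUV.T4Continuum.NE1pGaussianRegression
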